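import Mathlib
import Summits.NavierStokesRegularity.NavierStokesRegularity.Theorems.EulerZoomLiouvillePowerGaugeEulerLiouvilleSmallMomentBounds
import HarnessLib

/-!
# t56-SM, step 5: THE SMALL-MOMENT LAW `∫_{B_R} ‖curl V‖^{2p} ≤ C·R^{3 − 2p(2+ρ)}` (deliverable 2)
# (nsreg-p2 ROUND-52 §E `NsregP2.R52.Provenance.SmallMomentLaw ρ V`, r52/Sketch52E.lean 71b4a3bde833b3de l.76–82, VERBATIM unfolded;
# key 06:31:13Z; ezl-w3 g7 feasibility note `ns-ezl-w3-t56-SM-feasibility-g7.md` fd09e649b512eb91, steps 3–5;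
# seat ns-sfl-p1 g9, `--supports stmt-NavierStokesRegularity-19832 --as helper`)

With `M(s) = ∫ ψ_s (‖Ω‖²)^p` (`ψ_s(y) = σ(2 − ‖y‖²/s²)`), the flux identity of `…SmallMomentLimit` reads
`γ·s·M′(s) = (3γ − 2p)·M(s) + 2p·Str(s) − U(s)`, `Str(s) = ∫ ψ_s (‖Ω‖²)^{p−1}⟪Ω, DVΩ⟫`, `U(s) = ∫ (‖Ω‖²)^p · 2s⁻²σ′(2 − ‖y‖²/s²)⟪y, V y⟫`
(`dM/ds` by differentiation under the integral), so `G(s) = M(s)·s^{−a}`, `a = 3 − 2p/γ = 3 − 2p(2+ρ)`, has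
`G′(s) = s^{−a−1}((2p/γ)Str(s) − U(s)/γ)`.  The trivial moment bound (`…SmallMomentTools`), the weighted energy and the A-gauge give
`|Str(s)| ≤ C_S s^{2 − ρ/2 − p(2+ρ)}`, `|U(s)| ≤ C_U s^{1 − ρ − p(2+ρ)}` for `s ≥ 1`, so `G′ ≤ g` with `∫₁^∞ g < ∞` exactly when `p < ½`;
the ODE comparison on `[1, R]` (explicit power antiderivative) yields `M(R) ≤ C R^a` and `∫_{B_R}‖Ω‖^{2p} ≤ M(R)`.

HONEST FRAMING: an UPPER-bound instrument at the self-similar borderline rate (SEEDS-R53 S2 — the E-budget generalisation of Chae 2007,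
whose hypothesis `sup ‖DV‖ < ∞` the needle violates); it kills nothing by itself; nothing about the crux E (19832 OPEN) or NS regularity
is proved here. [nsreg-p2 R52 §E; folklore]
-/

noncomputable section

set_option linter.dupNamespace false

open Set Filter Topology Metric Function MeasureTheory InnerProductSpace
open scoped Topology ENNReal RealInnerProductSpace

namespace Summit.NavierStokesRegularity.NavierStokesRegularity.Theorems.PowerGaugeEulerLiouville

open Literature.Analysis Literature.Analysis.FluidPDE

namespace SmallMoment

/-! ## Assembly: the small-moment law -/

section Law

variable {V : EuclideanSpace ℝ (Fin 3) → EuclideanSpace ℝ (Fin 3)}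

/-- `√(c·(3s)^x) = √(c·3^x)·s^{x/2}` for `c ≥ 0`, `s ≥ 0`. [folklore] -/
theorem sqrt_const_mul_rpow_three_mul {c s : ℝ} (hc : 0 ≤ c) (hs : 0 ≤ s) (x : ℝ) :
    Real.sqrt (c * (3 * s) ^ x) = Real.sqrt (c * 3 ^ x) * s ^ (x / 2) := by
  rw [Real.mul_rpow (by norm_num) hs, ← mul_assoc, Real.sqrt_mul (mul_nonneg hc (Real.rpow_nonneg (by norm_num) _)),
    sqrt_rpow_eq hs]

/-- **The weighted moment `G(s) = M(s)·s^{−a}` and its scale derivative** (t56-SM steps 3: `dM/ds` under the integral, the flux split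
`∫(‖Ω‖²)^p Dψ_s[W] = −γD − U`, and `limit_identity`): for the profile with `γ = 1/(2+ρ)`, `0 < p < 1`, `s > 0`,
`G′(s) = s^{−a−1}·(2p·Str(s) − U(s))/γ`, `a = 3 − 2p(2+ρ)`. [nsreg-p2 R52 §E; folklore] -/
theorem hasDerivAt_weightedMoment {ρ : ℝ} (hρ2 : 0 < 2 + ρ) {P : EuclideanSpace ℝ (Fin 3) → ℝ}
    (hprof : IsSelfSimilarEulerProfile (1 / (2 + ρ)) 0 V P) {p : ℝ} (hp : 0 < p) (hp1 : p < 1) {s : ℝ} (hs : 0 < s) :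
    HasDerivAt (fun s : ℝ => (∫ y, Real.smoothTransition (2 - (s ^ 2)⁻¹ * ‖y‖ ^ 2) * (‖curl V y‖ ^ 2) ^ p) *
        s ^ (-(3 - 2 * p * (2 + ρ))))
      (s ^ (-(3 - 2 * p * (2 + ρ)) - 1) *
        ((2 * p * (∫ y, Real.smoothTransition (2 - (s ^ 2)⁻¹ * ‖y‖ ^ 2) *
              ((‖curl V y‖ ^ 2) ^ (p - 1) * ⟪curl V y, fderiv ℝ V y (curl V y)⟫)) -
            ∫ y, (‖curl V y‖ ^ 2) ^ p *
              (2 * (s ^ 2)⁻¹ * deriv Real.smoothTransition (2 - (s ^ 2)⁻¹ * ‖y‖ ^ 2) * ⟪y, V y⟫)) /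
          (1 / (2 + ρ)))) s := by
  set γ : ℝ := 1 / (2 + ρ) with hγdef
  have hγ0 : 0 < γ := by positivity
  have hγmul : γ * (2 + ρ) = 1 := by rw [hγdef]; field_simp
  set a : ℝ := 3 - 2 * p * (2 + ρ) with hadef
  -- regularity of the players
  have hV2 : ContDiff ℝ 2 V := hprof.contDiff_velocity
  have hVc : Continuous V := hV2.continuous
  have hΩc : Continuous (curl V) := (contDiff_one_curl hV2).continuous
  have hDVc : Continuous (fderiv ℝ V) := hV2.continuous_fderiv (by norm_cast)
  have htc : Continuous fun y => ‖curl V y‖ ^ 2 := hΩc.norm.pow 2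
  have hfc : Continuous fun y => (‖curl V y‖ ^ 2) ^ p := htc.rpow_const fun y => Or.inr hp.le
  have hψc : ∀ s : ℝ, Continuous (fun y : EuclideanSpace ℝ (Fin 3) => Real.smoothTransition (2 - (s ^ 2)⁻¹ * ‖y‖ ^ 2)) :=
    fun s => (WeakAxisym.contDiff_psiR s (n := 1)).continuous
  have hσc : Continuous (deriv Real.smoothTransition) :=
    (Real.smoothTransition.contDiff (n := 1)).continuous_deriv le_rfl
  have hσargc : ∀ s : ℝ, Continuous (fun y : EuclideanSpace ℝ (Fin 3) => deriv Real.smoothTransition (2 - (s ^ 2)⁻¹ * ‖y‖ ^ 2)) :=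
    fun s => hσc.comp (continuous_const.sub (continuous_const.mul (continuous_norm.pow 2)))
  have hσsupp : ∀ {s : ℝ}, 0 < s → HasCompactSupport (fun y : EuclideanSpace ℝ (Fin 3) =>
      deriv Real.smoothTransition (2 - (s ^ 2)⁻¹ * ‖y‖ ^ 2)) := by
    intro s hs
    refine HasCompactSupport.of_support_subset_isCompact (isCompact_closedBall (0 : EuclideanSpace ℝ (Fin 3)) (2 * s)) ?_
    intro y hy
    rw [mem_closedBall, dist_zero_right]
    by_contra h
    exact hy (deriv_sigma_arg_eq_zero hs (not_le.1 h))
  -- the functions of the scale `s`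
  set M : ℝ → ℝ := fun s => ∫ y, Real.smoothTransition (2 - (s ^ 2)⁻¹ * ‖y‖ ^ 2) * (‖curl V y‖ ^ 2) ^ p with hMdef
  set D : ℝ → ℝ := fun s => ∫ y, (‖curl V y‖ ^ 2) ^ p *
    (2 * (s ^ 2)⁻¹ * deriv Real.smoothTransition (2 - (s ^ 2)⁻¹ * ‖y‖ ^ 2) * ‖y‖ ^ 2) with hDdef
  set U : ℝ → ℝ := fun s => ∫ y, (‖curl V y‖ ^ 2) ^ p *
    (2 * (s ^ 2)⁻¹ * deriv Real.smoothTransition (2 - (s ^ 2)⁻¹ * ‖y‖ ^ 2) * ⟪y, V y⟫) with hUdef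
  set Str : ℝ → ℝ := fun s => ∫ y, Real.smoothTransition (2 - (s ^ 2)⁻¹ * ‖y‖ ^ 2) *
    ((‖curl V y‖ ^ 2) ^ (p - 1) * ⟪curl V y, fderiv ℝ V y (curl V y)⟫) with hStrdef
  -- (i) dM/ds = D/s
  have hM' : HasDerivAt M (D s / s) s := by
    have h := hasDerivAt_moment (f := fun y => (‖curl V y‖ ^ 2) ^ p) hfc hs
    have e := scale_mul_deriv_moment_eq (fun y => (‖curl V y‖ ^ 2) ^ p) hs.ne'
    have e' : (∫ y, deriv Real.smoothTransition (2 - (s ^ 2)⁻¹ * ‖y‖ ^ 2) * (2 * ‖y‖ ^ 2 * (s ^ 3)⁻¹) *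
        (‖curl V y‖ ^ 2) ^ p) = D s / s := by
      rw [eq_div_iff hs.ne', mul_comm, e]
    rw [← e']
    exact h
  -- (ii) the flux splits: ∫ f·Dψ_s[W] = −γ D − U
  have hflux : ∫ y, (‖curl V y‖ ^ 2) ^ p *
        fderiv ℝ (fun y : EuclideanSpace ℝ (Fin 3) => Real.smoothTransition (2 - (s ^ 2)⁻¹ * ‖y‖ ^ 2)) y
          (selfSimilarTransport γ 0 V y) = -γ * D s - U s := by
    have hptw : ∀ y, (‖curl V y‖ ^ 2) ^ p *
        fderiv ℝ (fun y : EuclideanSpace ℝ (Fin 3) => Real.smoothTransition (2 - (s ^ 2)⁻¹ * ‖y‖ ^ 2)) y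
          (selfSimilarTransport γ 0 V y) =
        -γ * ((‖curl V y‖ ^ 2) ^ p * (2 * (s ^ 2)⁻¹ * deriv Real.smoothTransition (2 - (s ^ 2)⁻¹ * ‖y‖ ^ 2) * ‖y‖ ^ 2)) -
          (‖curl V y‖ ^ 2) ^ p * (2 * (s ^ 2)⁻¹ * deriv Real.smoothTransition (2 - (s ^ 2)⁻¹ * ‖y‖ ^ 2) * ⟪y, V y⟫) := by
      intro y
      rw [WeakAxisym.fderiv_psiR_apply, selfSimilarTransport_apply, sub_zero, inner_add_right, real_inner_smul_right,
        real_inner_self_eq_norm_sq]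
      ring
    have hI1 : Integrable (fun y => (‖curl V y‖ ^ 2) ^ p *
        (2 * (s ^ 2)⁻¹ * deriv Real.smoothTransition (2 - (s ^ 2)⁻¹ * ‖y‖ ^ 2) * ‖y‖ ^ 2)) volume :=
      (hfc.mul (((continuous_const.mul (hσargc s)).mul (continuous_norm.pow 2)))).integrable_of_hasCompactSupport
        (((hσsupp hs).mul_left.mul_right).mul_left)
    have hI2 : Integrable (fun y => (‖curl V y‖ ^ 2) ^ p *
        (2 * (s ^ 2)⁻¹ * deriv Real.smoothTransition (2 - (s ^ 2)⁻¹ * ‖y‖ ^ 2) * ⟪y, V y⟫)) volume :=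
      (hfc.mul (((continuous_const.mul (hσargc s)).mul (continuous_id.inner hVc)))).integrable_of_hasCompactSupport
        (((hσsupp hs).mul_left.mul_right).mul_left)
    simp_rw [hptw]
    rw [integral_sub (hI1.const_mul _) hI2, integral_const_mul]
  -- (iii) the limit identity splits: ∫ f·Dψ_s[W] = −((3γ−2p) M + 2p Str)
  have hlim : ∫ y, (‖curl V y‖ ^ 2) ^ p *
        fderiv ℝ (fun y : EuclideanSpace ℝ (Fin 3) => Real.smoothTransition (2 - (s ^ 2)⁻¹ * ‖y‖ ^ 2)) y
          (selfSimilarTransport γ 0 V y) = -((3 * γ - 2 * p) * M s + 2 * p * Str s) := by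
    rw [limit_identity hprof hp hp1 hs]
    have hJ1 : Integrable (fun y => Real.smoothTransition (2 - (s ^ 2)⁻¹ * ‖y‖ ^ 2) * (‖curl V y‖ ^ 2) ^ p) volume :=
      ((hψc s).mul hfc).integrable_of_hasCompactSupport (WeakAxisym.hasCompactSupport_psiR hs).mul_right
    have hJ2 : Integrable (fun y => Real.smoothTransition (2 - (s ^ 2)⁻¹ * ‖y‖ ^ 2) *
        ((‖curl V y‖ ^ 2) ^ (p - 1) * ⟪curl V y, fderiv ℝ V y (curl V y)⟫)) volume := by
      refine Integrable.mono' (((hψc s).mul (hfc.mul hDVc.norm)).integrable_of_hasCompactSupport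
        (WeakAxisym.hasCompactSupport_psiR hs).mul_right) ?_ (ae_of_all _ fun y => ?_)
      · exact ((hψc s).measurable.mul ((htc.measurable.pow_const (p - 1)).mul
          (hΩc.inner (hDVc.clm_apply hΩc)).measurable)).aestronglyMeasurable
      · rw [Real.norm_eq_abs, abs_mul, abs_of_nonneg (WeakAxisym.psiR_nonneg s y)]
        refine mul_le_mul_of_nonneg_left ?_ (WeakAxisym.psiR_nonneg s y)
        rcases eq_or_lt_of_le (sq_nonneg ‖curl V y‖) with h0 | h0
        · have hΩ0 : curl V y = 0 := by
            have : ‖curl V y‖ = 0 := by nlinarith [norm_nonneg (curl V y), h0.symm]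
            exact norm_eq_zero.1 this
          simp [hΩ0, Real.zero_rpow hp.ne']
        · rw [abs_mul, abs_of_nonneg (Real.rpow_nonneg (sq_nonneg _) _)]
          calc (‖curl V y‖ ^ 2) ^ (p - 1) * |⟪curl V y, fderiv ℝ V y (curl V y)⟫|
              ≤ (‖curl V y‖ ^ 2) ^ (p - 1) * (‖curl V y‖ ^ 2 * ‖fderiv ℝ V y‖) :=
                mul_le_mul_of_nonneg_left (abs_inner_fderiv_apply_le y) (Real.rpow_nonneg (sq_nonneg _) _)
            _ = (‖curl V y‖ ^ 2) ^ p * ‖fderiv ℝ V y‖ := by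
                have : (‖curl V y‖ ^ 2) ^ (p - 1) * ‖curl V y‖ ^ 2 = (‖curl V y‖ ^ 2) ^ p := by
                  conv_lhs => rw [show (‖curl V y‖ ^ 2) ^ (p - 1) * ‖curl V y‖ ^ 2 =
                    (‖curl V y‖ ^ 2) ^ (p - 1) * (‖curl V y‖ ^ 2) ^ (1 : ℝ) by rw [Real.rpow_one]]
                  rw [← Real.rpow_add h0]; ring_nf
                rw [← mul_assoc, this]
    have e : ∀ y, Real.smoothTransition (2 - (s ^ 2)⁻¹ * ‖y‖ ^ 2) *
        ((3 * γ - 2 * p) * (‖curl V y‖ ^ 2) ^ p +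
          2 * p * ((‖curl V y‖ ^ 2) ^ (p - 1) * ⟪curl V y, fderiv ℝ V y (curl V y)⟫)) =
        (3 * γ - 2 * p) * (Real.smoothTransition (2 - (s ^ 2)⁻¹ * ‖y‖ ^ 2) * (‖curl V y‖ ^ 2) ^ p) +
          2 * p * (Real.smoothTransition (2 - (s ^ 2)⁻¹ * ‖y‖ ^ 2) *
            ((‖curl V y‖ ^ 2) ^ (p - 1) * ⟪curl V y, fderiv ℝ V y (curl V y)⟫)) := fun y => by ring
    simp_rw [e]
    rw [integral_add (hJ1.const_mul _) (hJ2.const_mul _), integral_const_mul, integral_const_mul]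
  -- (iv) the ODE identity, hence D − aM = (2p Str − U)/γ
  have hODE : D s - a * M s = (2 * p * Str s - U s) / γ := by
    have h1 := hflux
    rw [hlim] at h1
    rw [eq_div_iff hγ0.ne', hadef]
    have h2p : 2 * p * (2 + ρ) * γ = 2 * p := by
      calc 2 * p * (2 + ρ) * γ = 2 * p * (γ * (2 + ρ)) := by ring
        _ = 2 * p := by rw [hγmul, mul_one]
    linear_combination h1 + M s * h2p
  -- (v) G = M·s^{−a}
  have h1 : HasDerivAt (fun s : ℝ => s ^ (-a)) (-a * s ^ (-a - 1)) s := Real.hasDerivAt_rpow_const (Or.inl hs.ne')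
  have h := hM'.mul h1
  refine h.congr_deriv ?_
  have hODE' := hODE
  simp only [hStrdef, hUdef] at hODE'
  rw [← hODE']
  have e1 : s ^ (-a) = s ^ (-a - 1) * s := by
    conv_rhs => rw [show s ^ (-a - 1) * s = s ^ (-a - 1) * s ^ (1 : ℝ) by rw [Real.rpow_one], ← Real.rpow_add hs]
    ring_nf
  rw [e1]
  field_simp
  ring

/-- **The driving bound** (t56-SM step 4): for `s ≥ 1` the scale derivative of `G` is `≤ K·s^{−1−δ}`, `δ = (2+ρ)(½ − p) > 0`, by
`stretch_bound`/`drift_bound` and the exponent count `e_S = a − δ`, `e_U ≤ a − δ`. [nsreg-p2 R52 §E; folklore] -/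
theorem drive_bound {ρ : ℝ} (hρ : 0 < ρ) (hρ1 : ρ < 1) (hV : ContDiff ℝ 2 V) {p : ℝ} (hp : 0 < p) (hp12 : p < 1 / 2)
    (hE : (∫⁻ y, ‖fderiv ℝ V y‖ₑ ^ 2 * ENNReal.ofReal (‖y‖ ^ (ρ - 1))) ≠ ⊤)
    {A : ℝ} (hA : ∀ R : ℝ, 1 ≤ R → ∫ y in ball (0 : EuclideanSpace ℝ (Fin 3)) R, ‖V y‖ ^ 2 ≤ A * R ^ (1 - 2 * ρ)) :
    ∃ K : ℝ, 0 ≤ K ∧ ∀ s : ℝ, 1 ≤ s →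
      s ^ (-(3 - 2 * p * (2 + ρ)) - 1) *
        ((2 * p * (∫ y, Real.smoothTransition (2 - (s ^ 2)⁻¹ * ‖y‖ ^ 2) *
              ((‖curl V y‖ ^ 2) ^ (p - 1) * ⟪curl V y, fderiv ℝ V y (curl V y)⟫)) -
            ∫ y, (‖curl V y‖ ^ 2) ^ p *
              (2 * (s ^ 2)⁻¹ * deriv Real.smoothTransition (2 - (s ^ 2)⁻¹ * ‖y‖ ^ 2) * ⟪y, V y⟫)) /
          (1 / (2 + ρ))) ≤ K * s ^ (-1 - (2 + ρ) * (1 / 2 - p)) := by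
  obtain ⟨Mσ, hMσ0, hMσ⟩ := WeakAxisym.exists_bound_deriv_smoothTransition
  have hp2 : p ≤ 1 / 2 := hp12.le
  have h2ρ : 0 < 2 + ρ := by linarith
  set γ : ℝ := 1 / (2 + ρ) with hγdef
  have hγ0 : 0 < γ := by positivity
  set a : ℝ := 3 - 2 * p * (2 + ρ) with hadef
  set δ : ℝ := (2 + ρ) * (1 / 2 - p) with hδdef
  set Str : ℝ → ℝ := fun s => ∫ y, Real.smoothTransition (2 - (s ^ 2)⁻¹ * ‖y‖ ^ 2) *
    ((‖curl V y‖ ^ 2) ^ (p - 1) * ⟪curl V y, fderiv ℝ V y (curl V y)⟫) with hStrdef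
  set U : ℝ → ℝ := fun s => ∫ y, (‖curl V y‖ ^ 2) ^ p *
    (2 * (s ^ 2)⁻¹ * deriv Real.smoothTransition (2 - (s ^ 2)⁻¹ * ‖y‖ ^ 2) * ⟪y, V y⟫) with hUdef
  set Ew : ℝ := (∫⁻ y, ‖fderiv ℝ V y‖ₑ ^ 2 * ENNReal.ofReal (‖y‖ ^ (ρ - 1))).toReal with hEw
  have hEw0 : 0 ≤ Ew := ENNReal.toReal_nonneg
  have hA0 : 0 ≤ A := by
    have h := hA 1 le_rfl
    rw [Real.one_rpow, mul_one] at h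
    exact (integral_nonneg fun y => sq_nonneg _).trans h
  set K₁ : ℝ := (Real.pi * 4 / 3) ^ (1 - 4 * p / 2) * (16 * Ew) ^ (4 * p / 2) with hK₁
  have hK₁0 : 0 ≤ K₁ := by positivity
  set x₁ : ℝ := 3 * (1 - 4 * p / 2) + (1 - ρ) * (4 * p / 2) with hx₁
  set CS : ℝ := Real.sqrt (K₁ * 3 ^ x₁) * Real.sqrt (Ew * 3 ^ (1 - ρ)) with hCS
  set CU : ℝ := 4 * Mσ * (Real.sqrt (K₁ * 3 ^ x₁) * Real.sqrt (A * 3 ^ (1 - 2 * ρ))) with hCU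
  have hCS0 : 0 ≤ CS := by positivity
  have hCU0 : 0 ≤ CU := by positivity
  have hStr_le : ∀ {s : ℝ}, 1 ≤ s → |Str s| ≤ CS * s ^ (x₁ / 2 + (1 - ρ) / 2) := by
    intro s hs
    have hs0 : 0 < s := by linarith
    have h := stretch_bound (V := V) hρ1 hp hp2 hV hE hs
    calc |Str s| ≤ ∫ y, |Real.smoothTransition (2 - (s ^ 2)⁻¹ * ‖y‖ ^ 2) *
            ((‖curl V y‖ ^ 2) ^ (p - 1) * ⟪curl V y, fderiv ℝ V y (curl V y)⟫)| := abs_integral_le_integral_abs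
      _ ≤ Real.sqrt (K₁ * (3 * s) ^ x₁) * Real.sqrt ((3 * s) ^ (1 - ρ) * Ew) := h
      _ = CS * s ^ (x₁ / 2 + (1 - ρ) / 2) := by
          rw [show (3 * s) ^ (1 - ρ) * Ew = Ew * (3 * s) ^ (1 - ρ) by ring,
            sqrt_const_mul_rpow_three_mul hK₁0 hs0.le, sqrt_const_mul_rpow_three_mul hEw0 hs0.le, Real.rpow_add hs0, hCS]
          ring
  have hU_le : ∀ {s : ℝ}, 1 ≤ s → |U s| ≤ CU * s ^ (-1 + (x₁ / 2 + (1 - 2 * ρ) / 2)) := by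
    intro s hs
    have hs0 : 0 < s := by linarith
    have h := drift_bound (V := V) hρ1 hp hp2 hV hE hA hMσ0 hMσ hs
    calc |U s| ≤ ∫ y, |(‖curl V y‖ ^ 2) ^ p *
            (2 * (s ^ 2)⁻¹ * deriv Real.smoothTransition (2 - (s ^ 2)⁻¹ * ‖y‖ ^ 2) * ⟪y, V y⟫)| := abs_integral_le_integral_abs
      _ ≤ 4 * Mσ / s * (Real.sqrt (K₁ * (3 * s) ^ x₁) * Real.sqrt (A * (3 * s) ^ (1 - 2 * ρ))) := h
      _ = CU * s ^ (-1 + (x₁ / 2 + (1 - 2 * ρ) / 2)) := by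
          rw [sqrt_const_mul_rpow_three_mul hK₁0 hs0.le, sqrt_const_mul_rpow_three_mul hA0 hs0.le,
            Real.rpow_add hs0, Real.rpow_add hs0, Real.rpow_neg_one, hCU, div_eq_mul_inv]
          ring
  refine ⟨(2 * p * CS + CU) / γ, by positivity, fun s hs => ?_⟩
  have hs0 : 0 < s := by linarith
  have heS : x₁ / 2 + (1 - ρ) / 2 ≤ a - δ := by rw [hx₁, hadef, hδdef]; nlinarith
  have heU : -1 + (x₁ / 2 + (1 - 2 * ρ) / 2) ≤ a - δ := by rw [hx₁, hadef, hδdef]; nlinarith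
  have h1 : |Str s| ≤ CS * s ^ (a - δ) :=
    (hStr_le hs).trans (mul_le_mul_of_nonneg_left (Real.rpow_le_rpow_of_exponent_le hs heS) hCS0)
  have h2 : |U s| ≤ CU * s ^ (a - δ) :=
    (hU_le hs).trans (mul_le_mul_of_nonneg_left (Real.rpow_le_rpow_of_exponent_le hs heU) hCU0)
  have h3 : 2 * p * Str s - U s ≤ (2 * p * CS + CU) * s ^ (a - δ) := by
    have := (abs_le.1 h1).2
    have := (abs_le.1 h2).1
    nlinarith
  have e : s ^ (-a - 1) * s ^ (a - δ) = s ^ (-1 - δ) := by rw [← Real.rpow_add hs0]; ring_nf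
  show s ^ (-a - 1) * ((2 * p * Str s - U s) / γ) ≤ (2 * p * CS + CU) / γ * s ^ (-1 - δ)
  calc s ^ (-a - 1) * ((2 * p * Str s - U s) / γ)
      ≤ s ^ (-a - 1) * (((2 * p * CS + CU) * s ^ (a - δ)) / γ) := by gcongr
    _ = (2 * p * CS + CU) / γ * s ^ (-1 - δ) := by rw [← e]; ring

/-- ★★ **THE SMALL-MOMENT LAW** (`NsregP2.R52.Provenance.SmallMomentLaw ρ V` VERBATIM, unfolded; t56-SM deliverable 2): for a `C²` self-similar
Euler profile `(γ, 0, V, P)` with `γ = 1/(2+ρ)`, `0 < ρ < 1`, finite weighted energy `∫‖DV‖²‖y‖^{ρ−1} < ∞` and the A-gauge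
`∫_{B_R}‖V‖² ≤ A R^{1−2ρ}` (`R ≥ 1`), every vorticity moment of order `2p ∈ (0,1)` grows at most at the SELF-SIMILAR BORDERLINE rate:
`∫_{B_R} ‖curl V‖^{2p} ≤ C·R^{3 − 2p(2+ρ)}` for `R ≥ 1`.  Route (ezl-w3 g7 feasibility note fd09e649b512eb91): `limit_identity` ⇒
`γ s M′ = (3γ−2p)M + 2p·Str − U`; `G = M s^{−a}` has `G′ = s^{−a−1}((2p/γ)Str − U/γ) ≤ K s^{−1−δ}`, `δ = (2+ρ)(½ − p) > 0`
(`hasDerivAt_weightedMoment`, `drive_bound`); ODE comparison on `[1,R]` (`image_le_of_deriv_right_le_deriv_boundary`).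
HONEST LABEL: an UPPER bound (SEEDS-R53 S2), kills nothing. [nsreg-p2 R52 §E; folklore] -/
theorem smallMomentLaw {ρ : ℝ} (hρ : 0 < ρ) (hρ1 : ρ < 1) (V : EuclideanSpace ℝ (Fin 3) → EuclideanSpace ℝ (Fin 3)) :
    ∀ P : EuclideanSpace ℝ (Fin 3) → ℝ, IsSelfSimilarEulerProfile (1 / (2 + ρ)) 0 V P → ∀ p : ℝ, 0 < p → p < 1 / 2 →
      (∫⁻ y, ‖fderiv ℝ V y‖ₑ ^ 2 * ENNReal.ofReal (‖y‖ ^ (ρ - 1))) ≠ ⊤ →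
      (∃ A : ℝ, ∀ R : ℝ, 1 ≤ R → ∫ y in Metric.ball (0 : EuclideanSpace ℝ (Fin 3)) R, ‖V y‖ ^ 2 ≤ A * R ^ (1 - 2 * ρ)) →
        ∃ C : ℝ, ∀ R : ℝ, 1 ≤ R →
          ∫ y in Metric.ball (0 : EuclideanSpace ℝ (Fin 3)) R, ‖curl V y‖ ^ (2 * p) ≤ C * R ^ (3 - 2 * p * (2 + ρ)) := by
  intro P hprof p hp hp12 hE hAex
  obtain ⟨A, hA⟩ := hAex
  have hp1 : p < 1 := by linarith
  have h2ρ : 0 < 2 + ρ := by linarith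
  set a : ℝ := 3 - 2 * p * (2 + ρ) with hadef
  set δ : ℝ := (2 + ρ) * (1 / 2 - p) with hδdef
  have hδ0 : 0 < δ := mul_pos h2ρ (by linarith)
  have hV2 : ContDiff ℝ 2 V := hprof.contDiff_velocity
  have hΩc : Continuous (curl V) := (contDiff_one_curl hV2).continuous
  have htc : Continuous fun y => ‖curl V y‖ ^ 2 := hΩc.norm.pow 2
  have hfc : Continuous fun y => (‖curl V y‖ ^ 2) ^ p := htc.rpow_const fun y => Or.inr hp.le
  have hf0 : ∀ y, 0 ≤ (‖curl V y‖ ^ 2) ^ p := fun y => Real.rpow_nonneg (sq_nonneg _) _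
  have hψc : ∀ s : ℝ, Continuous (fun y : EuclideanSpace ℝ (Fin 3) => Real.smoothTransition (2 - (s ^ 2)⁻¹ * ‖y‖ ^ 2)) :=
    fun s => (WeakAxisym.contDiff_psiR s (n := 1)).continuous
  -- the functions of the scale
  set M : ℝ → ℝ := fun s => ∫ y, Real.smoothTransition (2 - (s ^ 2)⁻¹ * ‖y‖ ^ 2) * (‖curl V y‖ ^ 2) ^ p with hMdef
  set F' : ℝ → ℝ := fun s => s ^ (-a - 1) *
    ((2 * p * (∫ y, Real.smoothTransition (2 - (s ^ 2)⁻¹ * ‖y‖ ^ 2) *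
          ((‖curl V y‖ ^ 2) ^ (p - 1) * ⟪curl V y, fderiv ℝ V y (curl V y)⟫)) -
        ∫ y, (‖curl V y‖ ^ 2) ^ p *
          (2 * (s ^ 2)⁻¹ * deriv Real.smoothTransition (2 - (s ^ 2)⁻¹ * ‖y‖ ^ 2) * ⟪y, V y⟫)) /
      (1 / (2 + ρ))) with hF'def
  set G : ℝ → ℝ := fun s => M s * s ^ (-a) with hGdef
  have hG' : ∀ {s : ℝ}, 0 < s → HasDerivAt G (F' s) s := fun hs =>
    hasDerivAt_weightedMoment h2ρ hprof hp hp1 hs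
  obtain ⟨K, hK0, hdrive⟩ := drive_bound (V := V) hρ hρ1 hV2 hp hp12 hE hA
  -- ODE comparison on [1, R]
  have hmain : ∀ {R : ℝ}, 1 ≤ R → G R ≤ G 1 + K / δ := by
    intro R hR
    set B : ℝ → ℝ := fun s => G 1 + K * (1 - s ^ (-δ)) / δ with hBdef
    have hB' : ∀ {s : ℝ}, 0 < s → HasDerivAt B (K * s ^ (-1 - δ)) s := by
      intro s hs
      have h1 : HasDerivAt (fun s : ℝ => s ^ (-δ)) (-δ * s ^ (-δ - 1)) s := Real.hasDerivAt_rpow_const (Or.inl hs.ne')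
      have h2 := ((h1.const_sub 1).const_mul K).div_const δ |>.const_add (G 1)
      refine h2.congr_deriv ?_
      rw [show -δ - 1 = -1 - δ by ring]
      field_simp
    have hcmp := image_le_of_deriv_right_le_deriv_boundary (f := G) (f' := F') (a := 1) (b := R)
      (fun s hs => (hG' (by linarith [hs.1])).continuousAt.continuousWithinAt)
      (fun s hs => (hG' (by linarith [hs.1])).hasDerivWithinAt)
      (B := B) (B' := fun s => K * s ^ (-1 - δ)) (by rw [hBdef]; simp)
      (fun s hs => (hB' (by linarith [hs.1])).continuousAt.continuousWithinAt)
      (fun s hs => (hB' (by linarith [hs.1])).hasDerivWithinAt)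
      (fun s hs => hdrive s hs.1) (right_mem_Icc.2 hR)
    have hRδ : 0 ≤ R ^ (-δ) := Real.rpow_nonneg (by linarith) _
    have hfrac : K * (1 - R ^ (-δ)) / δ ≤ K / δ := by
      apply div_le_div_of_nonneg_right _ hδ0.le
      have : K * (1 - R ^ (-δ)) = K - K * R ^ (-δ) := by ring
      rw [this]
      linarith [mul_nonneg hK0 hRδ]
    have hBR : B R = G 1 + K * (1 - R ^ (-δ)) / δ := rfl
    calc G R ≤ B R := hcmp
      _ ≤ G 1 + K / δ := by rw [hBR]; linarith
  -- conclusion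
  refine ⟨M 1 + K / δ, fun R hR => ?_⟩
  have hR0 : 0 < R := by linarith
  have hG1 : G 1 = M 1 := by rw [hGdef]; simp
  have hMR : M R = G R * R ^ a := by
    rw [hGdef]; simp only
    rw [mul_assoc, ← Real.rpow_add hR0, neg_add_cancel, Real.rpow_zero, mul_one]
  have hM_le : M R ≤ (M 1 + K / δ) * R ^ a := by
    rw [hMR, ← hG1]
    exact mul_le_mul_of_nonneg_right (hmain hR) (Real.rpow_nonneg hR0.le _)
  have hball : ∫ y in Metric.ball (0 : EuclideanSpace ℝ (Fin 3)) R, ‖curl V y‖ ^ (2 * p) ≤ M R := by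
    have hJ : Integrable (fun y => Real.smoothTransition (2 - (R ^ 2)⁻¹ * ‖y‖ ^ 2) * (‖curl V y‖ ^ 2) ^ p) volume :=
      ((hψc R).mul hfc).integrable_of_hasCompactSupport (WeakAxisym.hasCompactSupport_psiR hR0).mul_right
    have e : ∫ y in Metric.ball (0 : EuclideanSpace ℝ (Fin 3)) R, ‖curl V y‖ ^ (2 * p) =
        ∫ y, (Metric.ball (0 : EuclideanSpace ℝ (Fin 3)) R).indicator (fun y => (‖curl V y‖ ^ 2) ^ p) y := by
      rw [integral_indicator measurableSet_ball]
      exact integral_congr_ae (ae_of_all _ fun y => (sq_rpow_eq _ _ (norm_nonneg _)).symm)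
    rw [e, hMdef]
    refine integral_mono ?_ hJ fun y => ?_
    · rw [integrable_indicator_iff measurableSet_ball]
      exact (hfc.continuousOn.integrableOn_compact (isCompact_closedBall _ _)).mono_set ball_subset_closedBall
    · by_cases hy : y ∈ Metric.ball (0 : EuclideanSpace ℝ (Fin 3)) R
      · rw [indicator_of_mem hy, WeakAxisym.psiR_eq_one_of_le hR0 (mem_ball_zero_iff.1 hy).le, one_mul]
      · rw [indicator_of_notMem hy]
        exact mul_nonneg (WeakAxisym.psiR_nonneg R y) (hf0 y)
  exact hball.trans hM_le

end Law

end SmallMoment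

end Summit.NavierStokesRegularity.NavierStokesRegularity.Theorems.PowerGaugeEulerLiouville

end
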